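import Summits.QuantumFields.BalabanUV.Beta.EriceFlowEnclosureB12AsPrintedPointwiseFadingDrift

/-!
# Beta / EriceFlowEnclosureB12AsPrintedPointwiseFadingEventualAF — WHAT (0.31) FORCES, part 10b: THE TYPED THEOREM 2 + node U2's COUPLING-CHART FADING MEMORY + NE4 FORCE THE
# EVENTUAL ASYMPTOTIC-FREEDOM LETTER `T4CouplingMatching.EventualLowerH b δ k₀` NEAR ZERO.  Part 10 (`…PointwiseFadingDrift`) gave the constant-history sequence
# `b_k := β_{k+1}(δ, …, δ)` two-sided LINEAR DRIFT with a √N defect from the typed Theorem 2 and the moduli.  NE4 (`ScaleShiftRate c θ γ β`: |β_{k+2}(w) − β_{k+1}(tail w)| ≤ cθ^k) compares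
# consecutive β-functions at tail-related histories — and a constant history IS its own tail, so `|b_{k+1} − b_k| ≤ cθ^k`: the reference sequence is geometrically Cauchy (§1).  A sequence
# with Cesàro drift ≥ 3s∕4 − o(1) whose increments are summably small is bounded below POINTWISE: `b_k ≥ 3s∕4 − cθ^k∕(1−θ)` (§2 `const_ge_of_runs_NE4`: windows N = M², divide, M → ∞), and
# moving back to any history of the small box costs `Cδ∕(1−θ) ≤ s∕4`: **`lower_transient_of_runs_NE4`** (`β_{k+1} ≥ s∕2 − cθ^k∕(1−θ)` on ]0, δ]^{k+1}, every k) ⟹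
# **`eventualLowerH_of_runs_NE4`** (`EventualLowerH (s∕4) δ k₀ β` once `cθ^{k₀} ≤ (1−θ)s∕4`).  On the as-printed carrier: **`eventualLowerH_of_theorem2_fadingMemory_NE4`** —
# `Theorem2Statement S hL` AS TYPED + `hrg` + `HistLipschitz Λ γ_U S.β` with `FadingMemory C θ Λ` + `ScaleShiftRate c θ γ_U S.β` (0 ≤ θ < 1) ⟹ ∃ b > 0, δ ∈ ]0, γ_U], k₀ with
# `EventualLowerH b δ k₀ S.β`.  So the answer to bflow-p1 #64d's question («a toy where even `EventualLowerH b γ k₀` fails for all b > 0, k₀ while Theorem 2 typed + NE4 + fading memory hold would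
# separate the bookings strictly») is: NO SUCH TOY near zero — on node U2's own hypotheses the eventual AF letter (T09.F, `Dag.Leaves.betaPositive` in eventual form; UNPRINTED) is a
# CONSEQUENCE of the typed (0.31), not an input.  Sharp: not from scale 0 ∕ not the sign (part 8b's ramp #61g has all hypotheses incl. NE4 — bflow-p1 #64d `scaleShiftRate_ramp` — and
# β_2(δ, δ∕3) < 0), not without NE4 (scale-alternating families: gaps cell `Gaps/CapAvgAFNecessary.not_eventualLowerH_alt` with `betaAvgAFH_alt`; part 10's carrier survives, the floor does not).
# §2b isolates the mechanism at the level of crew CAP's carrier: `BetaAvgAFH s D γ` + NE4 + the moduli ⟹ the eventual letter near zero — NO runs, NO Theorem 2 (`eventualLowerH_of_betaAvgAFH_NE4`)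
# (β-flow team, prover 2 = lower ∕ positivity side, unit `b2b-balaban-beta-bflow-p2`, gen 46; ROW AP-I × node U2's letters; END of the booking in part 10c `…EventualAFEnd`)

HONEST FRAMING (page 1 of everything the β sub-cell writes): discharging `BetaPertH` makes Bałaban's UV stability UNCONDITIONAL — a
real constructive-QFT result; it is NOT the continuum limit and NOT the Clay problem.  HONEST DEPENDENCY (cell reorg 2026-08-19,
verbatim): «continuum YM on T⁴ ⇐ BetaPertH ∧ nine spine estimates (0/9 proved); BetaPertH ⇐ (D1) ∧ (D4) ∧ CAP+tail; G-an2-4 gates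
asym, D1 and NE2/3/4.»  THIS MODULE DISCHARGES NOTHING: §1–§2 are [folklore] finite-sum ∕ limit calculus for an ABSTRACT `β : FlowStep.HBeta` under node U2's HYPOTHESIS SHAPES
`T4CouplingMatching.HistLipschitz ∕ FadingMemory ∕ ScaleShiftRate` (NONE printed — [Balaban1987RG1] = T. Bałaban, Commun. Math. Phys. **109** (1987) p. 298 says only that β_j *"depends
also on all preceding coupling constants"*, p. 264 *"We will investigate other properties in a separate paper"*; GAPS G-t4-U2-1 ∕ G-t4-U2-2) and a displayed family of runs of (0.20) p. 256 with
the discrete two-sided (0.31) p. 259; §3 is bookkeeping BY NAME over the NAMED FIELDS of `B12BetaAsPrinted` (`Theorem2Statement` — STATED WITHOUT PROOF in print, p. 259; [Balaban1989LargeFieldII]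
p. 355 «has not been published yet» — a HYPOTHESIS) with prover 1's binder `hrg` ∕ the upper letter (U).  `EventualLowerH` is node U2's HYPOTHESIS SHAPE, here a CONCLUSION for an abstract
setting; nothing is asserted about Bałaban's β-functions (1.22), their sign, floor, moduli or scale-shift rate.

WHAT THIS FILE PROVES (0 sorry, 0 def):
§1 `const_le_const_add` (NE4 ⟹ `b_j ≤ b_k + cθ^k∕(1−θ)` for j ≥ k along the constant history).
§2 **`const_ge_of_runs_NE4`** (`b_k ≥ 3s∕4 − cθ^k∕(1−θ)` for EVERY k), **`lower_transient_of_runs_NE4`** (`β_{k+1}(v) ≥ s∕2 − cθ^k∕(1−θ)` on ]0, δ]^{k+1}),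
   **`eventualLowerH_of_runs_NE4`** (`EventualLowerH (s∕4) δ k₀ β` for `cθ^{k₀} ≤ (1−θ)s∕4`), `exists_threshold`.
§2b THE MECHANISM AT THE CARRIER LEVEL (no runs, no Theorem 2): **`lower_transient_of_betaAvgAFH_NE4`** ∕ **`eventualLowerH_of_betaAvgAFH_NE4`** — crew CAP's `BetaAvgAFH s D γ β` (read along the
   constant history) + NE4 + the moduli ⟹ `β_{k+1} ≥ s∕2 − cθ^k∕(1−θ)` on ]0, δ]^{k+1} (2Cδ ≤ s(1−θ)) and `EventualLowerH (s∕4) δ k₀ β`: a certified carrier slice + NE4 already give node U2's input.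
§3 **`eventualLowerH_of_theorem2_fadingMemory_NE4`** (THE END: ∃ b > 0 ∃ δ ∈ ]0, γ_U] ∃ k₀, `EventualLowerH b δ k₀ S.β`), `lower_transient_of_theorem2_fadingMemory_NE4` (explicit: the slope from ONE
   endpoint, every small box, the transient `cθ^k∕(1−θ)` displayed), `eventualLowerH_of_theorem2_fadingMemory_NE4'` (`hrg` discharged from `Definitions` + (U)).
NOT CLAIMED: any floor, sign, modulus or scale-shift rate for Bałaban's β; which reading print intends; Theorem 2; `BetaPertH`; continuum; Clay.
-/

namespace Summit.QuantumFields.BalabanUV.Beta.EriceFlowEnclosureB12AsPrintedPointwiseFadingEventualAF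

open Finset
open Literature.MathematicalPhysics.QuantumFieldTheory.Balaban1983to89
open Literature.MathematicalPhysics.QuantumFieldTheory.Balaban1983to89.B12BetaAsPrinted
open Literature.MathematicalPhysics.QuantumFieldTheory.Balaban1983to89.FlowStep (HBeta prefixOf Box mem_box box_mono RGEqH BetaUpperH BetaLowerH)
open Literature.MathematicalPhysics.QuantumFieldTheory.Balaban1983to89.T4CouplingMatching (HistLipschitz FadingMemory ScaleShiftRate
  EventualLowerH)
open Summit.QuantumFields.BalabanUV.Beta.EriceFlowEnclosureB12AsPrintedTunedUpper (hrg_of_betaUpperH)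
open Summit.QuantumFields.BalabanUV.Beta.EriceFlowEnclosureB12AsPrintedPointwiseFadingDrift

noncomputable section

/-! ## §1 Under NE4 the constant-history sequence is geometrically Cauchy -/

/-- **NE4 ALONG THE CONSTANT HISTORY.**  `ScaleShiftRate c θ γ β` (0 ≤ θ < 1) and `0 < δ ≤ γ` ⟹ `b_j ≤ b_k + cθ^k∕(1−θ)` for all `j ≥ k`, `b_j := β_{j+1}(δ, …, δ)`: a constant history is
its own tail, so consecutive b's differ by at most cθ^j, and the geometric series sums. [folklore] -/
theorem const_le_const_add {β : HBeta} {γ c θ δ : ℝ} (hS : ScaleShiftRate c θ γ β) (hθ0 : 0 ≤ θ) (hθ1 : θ < 1) (hδ : 0 < δ) (hδγ : δ ≤ γ)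
    {k j : ℕ} (hkj : k ≤ j) :
    β j (fun _ : Fin (j + 1) => δ) ≤ β k (fun _ : Fin (k + 1) => δ) + c * θ ^ k / (1 - θ) := by
  have hstep : ∀ l : ℕ, β (l + 1) (fun _ : Fin (l + 2) => δ) - β l (fun _ : Fin (l + 1) => δ) ≤ c * θ ^ l := by
    intro l
    have hw : (fun _ : Fin (l + 2) => δ) ∈ Box γ (l + 1) := mem_box.mpr fun _ => ⟨hδ, hδγ⟩
    have h := hS l (fun _ => δ) hw
    have htail : Fin.tail (fun _ : Fin (l + 2) => δ) = fun _ : Fin (l + 1) => δ := rfl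
    rw [htail] at h
    exact (abs_le.mp h).2
  -- telescope
  have htel : β j (fun _ : Fin (j + 1) => δ) - β k (fun _ : Fin (k + 1) => δ) ≤ ∑ l ∈ Ico k j, c * θ ^ l := by
    induction j, hkj using Nat.le_induction with
    | base => simp
    | succ j hkj ih =>
      rw [Finset.sum_Ico_succ_top hkj]
      linarith [hstep j, ih]
  have hgeom : ∑ l ∈ Ico k j, c * θ ^ l ≤ c * θ ^ k / (1 - θ) := by
    have hc : 0 ≤ c := by
      have h := hS 0 (fun _ => δ) (mem_box.mpr fun _ => ⟨hδ, hδγ⟩)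
      have := (abs_nonneg _).trans h
      simpa using this
    rw [← Finset.mul_sum, mul_div_assoc]
    exact mul_le_mul_of_nonneg_left (geom_sum_Ico_le_of_lt_one hθ0 hθ1) hc
  linarith

/-! ## §2 Cesàro drift + geometric Cauchy ⟹ a POINTWISE floor on the constant-history sequence, hence the eventual AF letter on the small box -/

/-- **THE CONSTANT-HISTORY VALUES ARE EVENTUALLY BOUNDED BELOW.**  Node U2's moduli `HistLipschitz Λ γ β` with `FadingMemory C θ Λ` and NE4 `ScaleShiftRate c θ γ β` (0 ≤ θ < 1),
`0 < δ ≤ γ` with `4Cδ ≤ s(1−θ)`, and for every depth a run of (0.20) in ]0, γ] with the discrete two-sided (0.31) at slopes `0 < s ≤ s′` ⟹ for EVERY k: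
`β_{k+1}(δ, …, δ) ≥ 3s∕4 − cθ^k∕(1−θ)`.  Proof: part 10's drift gives `Σ_{j∈[k,k+N)} b_j ≥ sN − (s∕4)N − A√N − B`, NE4 gives `Σ ≤ N(b_k + cθ^k∕(1−θ))`; divide by N = M² and let
M → ∞ (`le_of_forall_pos_le_add`). [cite: Balaban1987RG1, Thm 2 (0.31) p.259 with (0.20) p.256 and §5 p.298] -/
theorem const_ge_of_runs_NE4 {β : HBeta} {γ C c θ δ s s' : ℝ} {Λ : ℕ → ℕ → ℝ} (hL : HistLipschitz Λ γ β) (hΛ : FadingMemory C θ Λ)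
    (hS : ScaleShiftRate c θ γ β) (hθ0 : 0 ≤ θ) (hθ1 : θ < 1) (hC : 0 ≤ C) (hδ : 0 < δ) (hδγ : δ ≤ γ) (hs : 0 < s)
    (hsmall : 4 * C * δ ≤ s * (1 - θ))
    (hruns : ∀ K : ℕ, ∃ r : ℕ → ℝ, RGEqH K β r ∧ Step.InInterval γ K r ∧ Step.Discrete031 s s' K (r K) r) (k : ℕ) :
    3 * s / 4 - c * θ ^ k / (1 - θ) ≤ β k (fun _ : Fin (k + 1) => δ) := by
  have h1θ : 0 < 1 - θ := by linarith
  have hγ : 0 < γ := hδ.trans_le hδγ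
  have hCδ : C * δ / (1 - θ) ≤ s / 4 := by rw [div_le_iff₀ h1θ]; linarith
  set A : ℝ := 2 * C / ((1 - θ) * Real.sqrt s) with hA
  set B : ℝ := C * γ * θ / (1 - θ) ^ 2 with hB
  have hA0 : 0 ≤ A := by rw [hA]; positivity
  have hB0 : 0 ≤ B := by rw [hB]; positivity
  set b : ℝ := β k (fun _ : Fin (k + 1) => δ) with hb
  -- for every M ≥ 1 (window N = M²): 3s/4 − (A + B)/M ≤ b + cθ^k/(1−θ)
  have hM : ∀ M : ℕ, 1 ≤ M → 3 * s / 4 - (A + B) / M ≤ b + c * θ ^ k / (1 - θ) := by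
    intro M hM1
    have hMpos : (0 : ℝ) < M := by exact_mod_cast hM1
    have hlow := (constDrift_of_runs hL hΛ hθ0 hθ1 hC hδ hδγ hs hruns k (M * M)).1
    have hup : ∑ j ∈ Ico k (k + M * M), β j (fun _ : Fin (j + 1) => δ) ≤ (M * M : ℕ) * (b + c * θ ^ k / (1 - θ)) := by
      calc ∑ j ∈ Ico k (k + M * M), β j (fun _ : Fin (j + 1) => δ) ≤ ∑ j ∈ Ico k (k + M * M), (b + c * θ ^ k / (1 - θ)) :=
            Finset.sum_le_sum fun j hj => const_le_const_add hS hθ0 hθ1 hδ hδγ (mem_Ico.mp hj).1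
        _ = (M * M : ℕ) * (b + c * θ ^ k / (1 - θ)) := by rw [Finset.sum_const, Nat.card_Ico, Nat.add_sub_cancel_left, nsmul_eq_mul]
    have hsqrt : Real.sqrt ((M * M : ℕ) : ℝ) = M := by
      rw [Nat.cast_mul, Real.sqrt_mul_self hMpos.le]
    rw [hsqrt] at hlow
    have hMM : ((M * M : ℕ) : ℝ) = (M : ℝ) * M := by push_cast; ring
    rw [hMM] at hlow hup
    -- divide by M²
    have hNC : C * δ / (1 - θ) * ((M : ℝ) * M) ≤ s / 4 * ((M : ℝ) * M) := mul_le_mul_of_nonneg_right hCδ (by positivity)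
    have hBM : B ≤ B * M := le_mul_of_one_le_right hB0 (by exact_mod_cast hM1)
    have key : (3 * s / 4 - (A + B) / M) * ((M : ℝ) * M) ≤ (b + c * θ ^ k / (1 - θ)) * ((M : ℝ) * M) := by
      have e : (3 * s / 4 - (A + B) / M) * ((M : ℝ) * M) = 3 * s / 4 * (M * M) - A * M - B * M := by
        field_simp; ring
      rw [e]
      nlinarith [hlow, hup, hNC, hBM]
    exact le_of_mul_le_mul_right key (by positivity)
  -- let M → ∞
  refine le_of_forall_pos_le_add fun ε hε => ?_
  obtain ⟨M, hMε⟩ := exists_nat_gt ((A + B) / ε)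
  have hM1 : 1 ≤ M := by
    rcases Nat.eq_zero_or_pos M with h0 | hpos
    · rw [h0, Nat.cast_zero] at hMε
      have : 0 ≤ (A + B) / ε := by positivity
      linarith
    · exact hpos
  have hMpos : (0 : ℝ) < M := by exact_mod_cast hM1
  have hdiv : (A + B) / M ≤ ε := by
    rw [div_le_iff₀ hMpos]
    have := (div_lt_iff₀ hε).mp hMε
    linarith
  linarith [hM M hM1, hdiv]

/-- **THE EVENTUAL AF LETTER WITH AN EXPLICIT TRANSIENT.**  Same hypotheses ⟹ on EVERY history of the small box, `β_{k+1}(v_0, …, v_k) ≥ s∕2 − cθ^k∕(1−θ)` for all k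
(`const_ge_of_runs_NE4` and the transfer `abs_sub_const_le_of_small`, cost `Cδ∕(1−θ) ≤ s∕4`). [cite: Balaban1987RG1, Thm 2 (0.31) p.259 with (0.20) p.256 and §5 p.298] -/
theorem lower_transient_of_runs_NE4 {β : HBeta} {γ C c θ δ s s' : ℝ} {Λ : ℕ → ℕ → ℝ} (hL : HistLipschitz Λ γ β) (hΛ : FadingMemory C θ Λ)
    (hS : ScaleShiftRate c θ γ β) (hθ0 : 0 ≤ θ) (hθ1 : θ < 1) (hC : 0 ≤ C) (hδ : 0 < δ) (hδγ : δ ≤ γ) (hs : 0 < s)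
    (hsmall : 4 * C * δ ≤ s * (1 - θ))
    (hruns : ∀ K : ℕ, ∃ r : ℕ → ℝ, RGEqH K β r ∧ Step.InInterval γ K r ∧ Step.Discrete031 s s' K (r K) r)
    (k : ℕ) {v : Fin (k + 1) → ℝ} (hv : v ∈ Box δ k) :
    s / 2 - c * θ ^ k / (1 - θ) ≤ β k v := by
  have h1θ : 0 < 1 - θ := by linarith
  have hCδ : C * δ / (1 - θ) ≤ s / 4 := by rw [div_le_iff₀ h1θ]; linarith
  have hconst := const_ge_of_runs_NE4 hL hΛ hS hθ0 hθ1 hC hδ hδγ hs hsmall hruns k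
  -- read v as the prefix of the history extended by δ
  set w : ℕ → ℝ := fun i => if h : i < k + 1 then v ⟨i, h⟩ else δ with hw
  have hwv : prefixOf w k = v := by
    funext i
    rw [FlowStep.prefixOf_apply]
    simp only [hw, dif_pos i.isLt, Fin.eta]
  have hwbox : ∀ i, 0 < w i ∧ w i ≤ δ := by
    intro i
    by_cases hi : i < k + 1
    · simp only [hw, hi, dif_pos]; exact mem_box.mp hv ⟨i, hi⟩
    · simp only [hw, hi, dif_neg, not_false_eq_true]; exact ⟨hδ, le_rfl⟩
  have htr := (abs_le.mp (abs_sub_const_le_of_small hL hΛ hθ0 hθ1 hC hδ hδγ (j := k) hwbox)).1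
  rw [hwv] at htr
  linarith

/-- **THE EVENTUAL AF LETTER `EventualLowerH (s∕4) δ k₀ β` (node U2's `T4CouplingMatching.EventualLowerH`, the `Beta.Assembly.LimitForm.tail_lower` shape) FROM A FAMILY OF (0.31)-RUNS UNDER
node U2's MODULI AND NE4** — for every threshold index k₀ with `cθ^{k₀} ≤ (1−θ)s∕4`. [cite: Balaban1987RG1, Thm 2 (0.31) p.259 with (0.20) p.256 and §5 p.298] -/
theorem eventualLowerH_of_runs_NE4 {β : HBeta} {γ C c θ δ s s' : ℝ} {Λ : ℕ → ℕ → ℝ} (hL : HistLipschitz Λ γ β) (hΛ : FadingMemory C θ Λ)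
    (hS : ScaleShiftRate c θ γ β) (hθ0 : 0 ≤ θ) (hθ1 : θ < 1) (hC : 0 ≤ C) (hδ : 0 < δ) (hδγ : δ ≤ γ) (hs : 0 < s)
    (hsmall : 4 * C * δ ≤ s * (1 - θ))
    (hruns : ∀ K : ℕ, ∃ r : ℕ → ℝ, RGEqH K β r ∧ Step.InInterval γ K r ∧ Step.Discrete031 s s' K (r K) r)
    {k₀ : ℕ} (hk₀ : c * θ ^ k₀ ≤ (1 - θ) * s / 4) :
    EventualLowerH (s / 4) δ k₀ β := by
  intro k v hk hv
  have h1θ : 0 < 1 - θ := by linarith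
  have h := lower_transient_of_runs_NE4 hL hΛ hS hθ0 hθ1 hC hδ hδγ hs hsmall hruns k hv
  have hc : 0 ≤ c := by
    have h0 := hS 0 (fun _ => δ) (mem_box.mpr fun _ => ⟨hδ, hδγ⟩)
    have := (abs_nonneg _).trans h0
    simpa using this
  have hθk : c * θ ^ k ≤ c * θ ^ k₀ := mul_le_mul_of_nonneg_left (pow_le_pow_of_le_one hθ0 hθ1.le hk) hc
  have hdiv : c * θ ^ k / (1 - θ) ≤ s / 4 := by
    rw [div_le_iff₀ h1θ]; linarith
  linarith

/-- Such a threshold index exists (θ < 1). [folklore] -/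
theorem exists_threshold {c θ s : ℝ} (hθ1 : θ < 1) (hs : 0 < s) :
    ∃ k₀ : ℕ, c * θ ^ k₀ ≤ (1 - θ) * s / 4 := by
  have h1θ : 0 < 1 - θ := by linarith
  rcases le_or_gt c 0 with hc | hc
  · refine ⟨0, ?_⟩
    rw [pow_zero, mul_one]
    have : 0 < (1 - θ) * s / 4 := by positivity
    linarith
  · obtain ⟨k₀, hk₀⟩ := exists_pow_lt_of_lt_one (show 0 < (1 - θ) * s / 4 / c by positivity) hθ1
    refine ⟨k₀, ?_⟩
    have := (lt_div_iff₀ hc).mp hk₀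
    linarith

/-! ## §2b The mechanism at the level of crew CAP's carrier: `BetaAvgAFH` + NE4 + the moduli ⟹ node U2's eventual letter (no runs, no Theorem 2) -/

/-- **CREW CAP's AVERAGED CARRIER + NE4 + node U2's MODULI ⟹ node U2's EVENTUAL AF LETTER.**  `BetaAvgAFH s D γ β` (window sums ≥ s(n−k) − D along EVERY ]0, γ]-history — in particular along the
CONSTANT history (δ, …, δ)), `ScaleShiftRate c θ γ β` and `HistLipschitz Λ γ β` with `FadingMemory C θ Λ` (0 ≤ θ < 1, 0 ≤ C), `0 < δ ≤ γ` with `2Cδ ≤ s(1−θ)` ⟹ for every k and every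
`v ∈ ]0, δ]^{k+1}`: `β_{k+1}(v) ≥ s∕2 − cθ^k∕(1−θ)`; hence `EventualLowerH (s∕4) δ k₀ β` once `cθ^{k₀} ≤ (1−θ)s∕4`.  (The carrier read along the constant history gives the Cesàro drift with defect D;
NE4 pins it pointwise; the moduli move it to the box.)  So on the R4-CAP road a certified `BetaAvgAFH` slice + NE4 + the moduli already give node U2's eventual pointwise input.
[cite: Balaban1987RG1, Thm 2 (0.31) p.259 with §5 p.298] -/
theorem lower_transient_of_betaAvgAFH_NE4 {β : HBeta} {γ C c θ δ s D : ℝ} {Λ : ℕ → ℕ → ℝ}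
    (hA : Literature.MathematicalPhysics.QuantumFieldTheory.Balaban1983to89.Beta.AveragedAFCarrier.BetaAvgAFH s D γ β)
    (hS : ScaleShiftRate c θ γ β) (hL : HistLipschitz Λ γ β) (hΛ : FadingMemory C θ Λ)
    (hθ0 : 0 ≤ θ) (hθ1 : θ < 1) (hC : 0 ≤ C) (hδ : 0 < δ) (hδγ : δ ≤ γ) (hsmall : 2 * C * δ ≤ s * (1 - θ))
    (k : ℕ) {v : Fin (k + 1) → ℝ} (hv : v ∈ Box δ k) :
    s / 2 - c * θ ^ k / (1 - θ) ≤ β k v := by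
  have h1θ : 0 < 1 - θ := by linarith
  have hCδ : C * δ / (1 - θ) ≤ s / 2 := by rw [div_le_iff₀ h1θ]; linarith
  set b : ℝ := β k (fun _ : Fin (k + 1) => δ) with hb
  -- the carrier along the constant history: Σ_{j∈[k,k+N)} b_j ≥ sN − D
  have hconst : ∀ i : ℕ, 0 < (fun _ : ℕ => δ) i ∧ (fun _ : ℕ => δ) i ≤ γ := fun _ => ⟨hδ, hδγ⟩
  have hwin : ∀ N : ℕ, s * N - D ≤ (N : ℝ) * (b + c * θ ^ k / (1 - θ)) := by
    intro N
    have h := hA (fun _ => δ) hconst k (k + N) (Nat.le_add_right k N)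
    have hcast : (((k + N : ℕ) : ℝ) - k) = (N : ℝ) := by push_cast; ring
    rw [hcast] at h
    have hpre : ∀ j : ℕ, prefixOf (fun _ : ℕ => δ) j = fun _ : Fin (j + 1) => δ := fun j => funext fun i => by simp
    have hup : ∑ j ∈ Ico k (k + N), β j (prefixOf (fun _ : ℕ => δ) j) ≤ (N : ℝ) * (b + c * θ ^ k / (1 - θ)) := by
      calc ∑ j ∈ Ico k (k + N), β j (prefixOf (fun _ : ℕ => δ) j) = ∑ j ∈ Ico k (k + N), β j (fun _ : Fin (j + 1) => δ) :=
            Finset.sum_congr rfl fun j _ => by rw [hpre j]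
        _ ≤ ∑ j ∈ Ico k (k + N), (b + c * θ ^ k / (1 - θ)) :=
            Finset.sum_le_sum fun j hj => const_le_const_add hS hθ0 hθ1 hδ hδγ (mem_Ico.mp hj).1
        _ = (N : ℝ) * (b + c * θ ^ k / (1 - θ)) := by rw [Finset.sum_const, Nat.card_Ico, Nat.add_sub_cancel_left, nsmul_eq_mul]
    linarith
  -- N → ∞
  have hbk : s ≤ b + c * θ ^ k / (1 - θ) := by
    refine le_of_forall_pos_le_add fun ε hε => ?_
    obtain ⟨N, hNε⟩ := exists_nat_gt (|D| / ε)
    have hN1 : (0 : ℝ) < N := by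
      have : 0 ≤ |D| / ε := by positivity
      exact_mod_cast Nat.pos_of_ne_zero (by rintro rfl; rw [Nat.cast_zero] at hNε; linarith)
    have h := hwin N
    have hDN : D ≤ ε * N := by
      have := (div_lt_iff₀ hε).mp hNε
      linarith [le_abs_self D]
    have key : s * N ≤ (N : ℝ) * (b + c * θ ^ k / (1 - θ) + ε) := by nlinarith
    exact le_of_mul_le_mul_left (by linarith [key]) hN1
  -- transfer to the box
  set w : ℕ → ℝ := fun i => if h : i < k + 1 then v ⟨i, h⟩ else δ with hw
  have hwv : prefixOf w k = v := by
    funext i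
    rw [FlowStep.prefixOf_apply]
    simp only [hw, dif_pos i.isLt, Fin.eta]
  have hwbox : ∀ i, 0 < w i ∧ w i ≤ δ := by
    intro i
    by_cases hi : i < k + 1
    · simp only [hw, hi, dif_pos]; exact mem_box.mp hv ⟨i, hi⟩
    · simp only [hw, hi, dif_neg, not_false_eq_true]; exact ⟨hδ, le_rfl⟩
  have htr := (abs_le.mp (abs_sub_const_le_of_small hL hΛ hθ0 hθ1 hC hδ hδγ (j := k) hwbox)).1
  rw [hwv] at htr
  linarith

/-- **`BetaAvgAFH` + NE4 + moduli ⟹ `EventualLowerH (s∕4) δ k₀ β`** for every threshold index with `cθ^{k₀} ≤ (1−θ)s∕4` (and `2Cδ ≤ s(1−θ)`). [cite: Balaban1987RG1, Thm 2 (0.31) p.259 with §5 p.298] -/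
theorem eventualLowerH_of_betaAvgAFH_NE4 {β : HBeta} {γ C c θ δ s D : ℝ} {Λ : ℕ → ℕ → ℝ}
    (hA : Literature.MathematicalPhysics.QuantumFieldTheory.Balaban1983to89.Beta.AveragedAFCarrier.BetaAvgAFH s D γ β)
    (hS : ScaleShiftRate c θ γ β) (hL : HistLipschitz Λ γ β) (hΛ : FadingMemory C θ Λ)
    (hθ0 : 0 ≤ θ) (hθ1 : θ < 1) (hC : 0 ≤ C) (hδ : 0 < δ) (hδγ : δ ≤ γ) (hs : 0 < s) (hsmall : 2 * C * δ ≤ s * (1 - θ))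
    {k₀ : ℕ} (hk₀ : c * θ ^ k₀ ≤ (1 - θ) * s / 4) :
    EventualLowerH (s / 4) δ k₀ β := by
  intro k v hk hv
  have h1θ : 0 < 1 - θ := by linarith
  have h := lower_transient_of_betaAvgAFH_NE4 hA hS hL hΛ hθ0 hθ1 hC hδ hδγ hsmall k hv
  have hc : 0 ≤ c := by
    have h0 := hS 0 (fun _ => δ) (mem_box.mpr fun _ => ⟨hδ, hδγ⟩)
    have := (abs_nonneg _).trans h0
    simpa using this
  have hθk : c * θ ^ k ≤ c * θ ^ k₀ := mul_le_mul_of_nonneg_left (pow_le_pow_of_le_one hθ0 hθ1.le hk) hc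
  have hdiv : c * θ ^ k / (1 - θ) ≤ s / 4 := by
    rw [div_le_iff₀ h1θ]; linarith
  have : 0 < s := hs
  linarith

/-! ## §3 On the as-printed carrier: the TYPED Theorem 2 + node U2's moduli + NE4 force the eventual AF letter near zero -/

variable {S : Setting}

/-- **THE TYPED THEOREM 2 + node U2's COUPLING-CHART FADING MEMORY + NE4 FORCE THE EVENTUAL ASYMPTOTIC-FREEDOM LETTER NEAR ZERO.**  `Theorem2Statement S hL` AS TYPED (constants after g) +
prover 1's binder `hrg` on ]0, γ_U] + `HistLipschitz Λ γ_U S.β` with `FadingMemory C θ Λ` + `ScaleShiftRate c θ γ_U S.β` (0 ≤ θ < 1, 0 ≤ C) ⟹ there are b > 0, δ ∈ ]0, γ_U] and k₀ with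
**`EventualLowerH b δ k₀ S.β`**: from scale k₀ on, EVERY β-function is ≥ b on the WHOLE box ]0, δ]^{k+1}.  So on node U2's own hypotheses the eventual form of the AF letter T09.F
(`Dag.Leaves.betaPositive`, UNPRINTED) is NOT an independent input near zero — it is a CONSEQUENCE of the typed (0.31).  Sharp on both counts: NOT from scale 0 ∕ NOT the sign (part 8b's ramp
setting #61g has every hypothesis here — NE4 by bflow-p1's #64d `scaleShiftRate_ramp` — and β_2(δ, δ∕3) < 0 in every box), and NOT without NE4 (families alternating in the scale, cf. the gaps cell's
`Gaps/CapAvgAFNecessary.altBeta`: carrier yes, eventual floor no). [cite: Balaban1987RG1, Thm 2 (0.31) p.259 with (0.20) p.256, §1 p.264 and §5 p.298] -/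
theorem eventualLowerH_of_theorem2_fadingMemory_NE4 {hL : Odd S.L ∧ 1 < S.L} (hT : Theorem2Statement S hL)
    {γU C c θ : ℝ} {Λ : ℕ → ℕ → ℝ} (hγU : 0 < γU) (hθ0 : 0 ≤ θ) (hθ1 : θ < 1) (hC : 0 ≤ C)
    (hrg : ∀ P : B12.RunParams, Step.InInterval γU P.K (S.cpl P) → RGEqH P.K S.β (S.cpl P))
    (hLip : HistLipschitz Λ γU S.β) (hΛ : FadingMemory C θ Λ) (hS : ScaleShiftRate c θ γU S.β) :
    ∃ b : ℝ, 0 < b ∧ ∃ δ : ℝ, 0 < δ ∧ δ ≤ γU ∧ ∃ k₀ : ℕ, EventualLowerH b δ k₀ S.β := by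
  obtain ⟨s, s', hs, -, hruns⟩ := runs_of_theorem2 hT hγU hrg
  have h1θ : 0 < 1 - θ := by linarith
  set δ : ℝ := min γU (s * (1 - θ) / (4 * (C + 1))) with hδdef
  have hδpos : 0 < δ := lt_min hγU (by positivity)
  have hδγ : δ ≤ γU := min_le_left _ _
  have hsmall : 4 * C * δ ≤ s * (1 - θ) := by
    have h1 : δ ≤ s * (1 - θ) / (4 * (C + 1)) := min_le_right _ _
    have h2 : 4 * (C + 1) * δ ≤ s * (1 - θ) := by rwa [le_div_iff₀ (by positivity), mul_comm] at h1
    nlinarith [hδpos.le]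
  obtain ⟨k₀, hk₀⟩ := exists_threshold (c := c) hθ1 hs
  exact ⟨s / 4, by positivity, δ, hδpos, hδγ, k₀, eventualLowerH_of_runs_NE4 hLip hΛ hS hθ0 hθ1 hC hδpos hδγ hs hsmall hruns hk₀⟩

/-- **Explicit form** (the slope from ONE endpoint, every small box, the transient displayed): same hypotheses ⟹ ∃ s > 0 such that for every `0 < δ ≤ γ_U` with `4Cδ ≤ s(1−θ)`, every k and
every `v ∈ ]0, δ]^{k+1}`: `β_{k+1}(v) ≥ s∕2 − cθ^k∕(1−θ)`. [cite: Balaban1987RG1, Thm 2 (0.31) p.259 with (0.20) p.256 and §5 p.298] -/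
theorem lower_transient_of_theorem2_fadingMemory_NE4 {hL : Odd S.L ∧ 1 < S.L} (hT : Theorem2Statement S hL)
    {γU C c θ : ℝ} {Λ : ℕ → ℕ → ℝ} (hγU : 0 < γU) (hθ0 : 0 ≤ θ) (hθ1 : θ < 1) (hC : 0 ≤ C)
    (hrg : ∀ P : B12.RunParams, Step.InInterval γU P.K (S.cpl P) → RGEqH P.K S.β (S.cpl P))
    (hLip : HistLipschitz Λ γU S.β) (hΛ : FadingMemory C θ Λ) (hS : ScaleShiftRate c θ γU S.β) :
    ∃ s : ℝ, 0 < s ∧ ∀ δ : ℝ, 0 < δ → δ ≤ γU → 4 * C * δ ≤ s * (1 - θ) →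
      ∀ (k : ℕ) (v : Fin (k + 1) → ℝ), v ∈ Box δ k → s / 2 - c * θ ^ k / (1 - θ) ≤ S.β k v := by
  obtain ⟨s, s', hs, -, hruns⟩ := runs_of_theorem2 hT hγU hrg
  exact ⟨s, hs, fun δ hδ hδγ hsmall k v hv => lower_transient_of_runs_NE4 hLip hΛ hS hθ0 hθ1 hC hδ hδγ hs hsmall hruns k hv⟩

/-- The same END with prover 1's binder `hrg` DISCHARGED from the printed `Definitions` and the upper letter (U) with Mγ_U² < 1. [cite: Balaban1987RG1, Thm 2 (0.31) p.259 with §1 p.264] -/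
theorem eventualLowerH_of_theorem2_fadingMemory_NE4' {hL : Odd S.L ∧ 1 < S.L} (hT : Theorem2Statement S hL) (hDef : Definitions S)
    {γU C c θ M : ℝ} {Λ : ℕ → ℕ → ℝ} (hγU : 0 < γU) (hθ0 : 0 ≤ θ) (hθ1 : θ < 1) (hC : 0 ≤ C)
    (hub : BetaUpperH M γU S.β) (hMγ : M * γU ^ 2 < 1)
    (hLip : HistLipschitz Λ γU S.β) (hΛ : FadingMemory C θ Λ) (hS : ScaleShiftRate c θ γU S.β) :
    ∃ b : ℝ, 0 < b ∧ ∃ δ : ℝ, 0 < δ ∧ δ ≤ γU ∧ ∃ k₀ : ℕ, EventualLowerH b δ k₀ S.β :=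
  eventualLowerH_of_theorem2_fadingMemory_NE4 hT hγU hθ0 hθ1 hC (hrg_of_betaUpperH hDef hγU hub hMγ) hLip hΛ hS

end

end Summit.QuantumFields.BalabanUV.Beta.EriceFlowEnclosureB12AsPrintedPointwiseFadingEventualAF
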